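import Mathlib
import Summits.RiemannHypothesis.RiemannHypothesis.Theorems.IntegerScrewFlatRange
import Summits.RiemannHypothesis.RiemannHypothesis.Theorems.IntegerScrewExitAtomTilt
import Summits.RiemannHypothesis.RiemannHypothesis.Theorems.IntegerScrewTiltPricing
import HarnessLib

/-!
# Route `IntegerScrew` — THEOREM B PACKAGED: the window law for the true `d = 1` cells `p² > R ≥ 298p`
# as ONE inequality with an absolute constant (CONTINUUM-LIMIT §25.10, §26.4)

The cell of THEOREM P₀ at the prime level `p` with room `R ∈ [298p, p²)` (`u = log R/log p ∈ (1, 2)`): atom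
`𝒜 = {x ≤ R : every prime factor of x is < p}` (`Nat.smoothNumbers p`) with harmonic weights, window
`W = 𝒜 ∩ (Q, R]`, `Q = R/p`, bottom `B = [1, Q]` (all of it `p`-free since `Q < p`), `c_𝒜 = exitMassRatioAtom R Q p`,
the atom's Dirichlet form `D_𝒜(g) = Σ_{x∈𝒜}(1/x)Σ_{n∣x}Λ(n)(g(x) − g(x/n))²`:

* **`theoremB`** — for `299 ≤ p`, `298p ≤ R < p²` and every `g : ℕ → ℝ`,
  `(Σ_{x∈W} g(x)/x − c_𝒜·Σ_{b≤Q} g(b)/b)² ≤ 30000000 · (log R/log(R/p))² · D_𝒜(g)`.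

With `X := log R/log Q ≈ u/(u−1)` this is THEOREM B of CONTINUUM-LIMIT 25.10 — `κ(p⁻, R, p) ≤ K_B(η)` on
`u ∈ [1 + η, 2)` — as a kernel statement with `K_B` explicit (`κ ≲ (H_Q/Ψ)(L/Ψ)·3·10⁷·X²`).  Assembly
(`window_functional_sq_le_atom_tilt_exp_five` with the profile `T(b) = log R/(log b + log p)` and the sharp Green
bound `A = 1 + 4/log(Q+1)`; PROP. 24.7 on the BOTTOM, `⌊log₂Q⌋`): FLOW `3A²L²/(2log²Q) ≤ 4.86·X²`; FLATTENED χ² `≤ H_Q·(m_hi − m_lo)²` (`flat_chiSq_le`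
with `B = 1 − 5/log(Q+1)`, `c′ = 1`, `E_lo = 3`, `E_hi = log 4` from the tree's Mertens files) with
`m_hi − m_lo ≤ 90·log R/log²(Q+1)` (`IntegerScrewFlatRange.flat_range_width_le`), times `3⌊log₂Q⌋e⁵` gives `≤ 6.25·10⁶·X²`; TILT
`3·2700²·D_Q ≤ 2.19·10⁷·D_𝒜` (`tilt_pricing`).  RH-free, elementary; `p` need not be prime for the inequality
(the cell interpretation needs it).  Nothing in this file bears on the truth of RH.
References: CONTINUUM-LIMIT §25.10, §26 (rh-explicit A6-PIVOT); M. Suzuki, J. Lond. Math. Soc. (2) 108 (2023)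
1448–1487 [Suzuki2023]; Hardy–Wright Thms 424–425 [HardyWright2008].
-/

noncomputable section

set_option linter.dupNamespace false -- D-0017: `Summit.<S>.<S>.…` is the designed namespace

namespace Summit.RiemannHypothesis.RiemannHypothesis.Theorems.IntegerScrew

open Finset Real
open ArithmeticFunction (vonMangoldt)

/-! ### THEOREM B -/

/-- For `θ ≤ R/p` and `R < p²` every `b ≤ θ` is `< p`, hence `p`-free. -/
theorem bottom_filter_eq_of_le {R p θ : ℕ} (hp : 1 ≤ p) (hR : R < p ^ 2) (hθ : θ ≤ R / p) :
    (Icc 1 θ).filter (· ∈ Nat.smoothNumbers p) = Icc 1 θ := by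
  refine Finset.filter_true_of_mem fun b hb => ?_
  have hb' := Finset.mem_Icc.1 hb
  have hQp : R / p < p := (Nat.div_lt_iff_lt_mul (by omega)).2 (by nlinarith)
  exact smooth_of_lt hb'.1 (by omega)

/-- The bottom's Dirichlet form is at most the atom's: `D_Q(g) ≤ D_𝒜(g)` (`[1, Q] ⊆ 𝒜`, `Q = R/p < p`). -/
theorem dirichlet_bottom_le_atom {R p : ℕ} (hp : 1 ≤ p) (hR : R < p ^ 2) (g : ℕ → ℝ) :
    ∑ x ∈ Icc 1 (R / p), (1 / (x : ℝ)) * ∑ n ∈ x.divisors, vonMangoldt n * (g x - g (x / n)) ^ 2 ≤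
      ∑ x ∈ (Icc 1 R).filter (· ∈ Nat.smoothNumbers p),
        (1 / (x : ℝ)) * ∑ n ∈ x.divisors, vonMangoldt n * (g x - g (x / n)) ^ 2 := by
  refine Finset.sum_le_sum_of_subset_of_nonneg ?_ fun x _ _ => mul_nonneg (by positivity)
    (Finset.sum_nonneg fun n _ => mul_nonneg ArithmeticFunction.vonMangoldt_nonneg (sq_nonneg _))
  rw [← bottom_filter_eq_of_le hp hR le_rfl]
  exact Finset.filter_subset_filter _ (Finset.Icc_subset_Icc_right (Nat.div_le_self R p))

/-- **THEOREM B (CONTINUUM-LIMIT §25.10, §26.4): the window law for the true `d = 1` cells, uniformly.**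
For `299 ≤ p`, `298p ≤ R < p²`, `Q = R/p`, the atom `𝒜 = p-smooth numbers ≤ R`, `c_𝒜 = exitMassRatioAtom R Q p`
and every `g : ℕ → ℝ`:

  `(Σ_{x∈𝒜, Q<x≤R} g(x)/x − c_𝒜·Σ_{b∈𝒜, b≤Q} g(b)/b)² ≤ 30000000·(log R/log Q)²·Σ_{x∈𝒜}(1/x)Σ_{n∣x}Λ(n)(g(x) − g(x/n))²`. -/
theorem theoremB {R p : ℕ} (hp : 299 ≤ p) (hpR : 298 * p ≤ R) (hR : R < p ^ 2) (g : ℕ → ℝ) :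
    (∑ x ∈ (Ioc (R / p) R).filter (· ∈ Nat.smoothNumbers p), g x / x -
        exitMassRatioAtom R (R / p) p *
          ∑ b ∈ (Icc 1 (R / p)).filter (· ∈ Nat.smoothNumbers p), g b / b) ^ 2 ≤
      30000000 * (Real.log R / Real.log ((R / p : ℕ) : ℝ)) ^ 2 *
        ∑ x ∈ (Icc 1 R).filter (· ∈ Nat.smoothNumbers p),
          (1 / (x : ℝ)) * ∑ n ∈ x.divisors, vonMangoldt n * (g x - g (x / n)) ^ 2 := by
  obtain ⟨hQ, h2Q, hQp⟩ := cell_nat_facts hp hpR hR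
  obtain ⟨hL2, hlamd, hlam1pos, hL201, ha5, haL⟩ := cell_log_facts hp hpR hR
  have hl2 := Real.log_two_lt_d9
  have hl2' := Real.log_two_gt_d9
  set Q := R / p with hQdef
  set a := Real.log ((Q : ℝ) + 1) with ha_def
  set L := Real.log (R : ℝ) with hL_def
  set ℓ := Real.log (Q : ℝ) with hℓ_def
  set lam := Real.log (p : ℝ) with hlam_def
  set DA := ∑ x ∈ (Icc 1 R).filter (· ∈ Nat.smoothNumbers p),
    (1 / (x : ℝ)) * ∑ n ∈ x.divisors, vonMangoldt n * (g x - g (x / n)) ^ 2 with hDA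
  set DQ := ∑ x ∈ Icc 1 Q, (1 / (x : ℝ)) * ∑ n ∈ x.divisors, vonMangoldt n * (g x - g (x / n)) ^ 2 with hDQ
  have hDAnn : 0 ≤ DA := Finset.sum_nonneg fun x _ => mul_nonneg (by positivity)
    (Finset.sum_nonneg fun n _ => mul_nonneg ArithmeticFunction.vonMangoldt_nonneg (sq_nonneg _))
  have hDQA : DQ ≤ DA := dirichlet_bottom_le_atom (by omega) hR g
  -- logs: 5.6 ≤ ℓ ≤ a ≤ L < 2λ, ℓ ≤ λ
  have hQr : (298 : ℝ) ≤ Q := by exact_mod_cast hQ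
  have hpr : (299 : ℝ) ≤ p := by exact_mod_cast hp
  have hℓ5 : 5 ≤ ℓ := by
    have := five_le_log_succ (show 148 ≤ Q - 1 by omega)
    have hc : ((Q - 1 : ℕ) : ℝ) + 1 = Q := by
      rw [Nat.cast_sub (by omega : 1 ≤ Q)]; push_cast; ring
    rw [hc] at this; exact this
  have hℓ0 : 0 < ℓ := by linarith
  have hℓa : ℓ ≤ a := Real.log_le_log (by linarith) (by linarith)
  have hℓL : ℓ ≤ L := hℓa.trans haL
  have hL0 : 0 < L := by linarith
  have hlam0 : 0 < lam := by linarith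
  have hℓlam : ℓ ≤ lam := by
    -- Q ≤ R/p < p
    exact Real.log_le_log (by linarith) (by exact_mod_cast hQp.le)
  have hX1 : 1 ≤ L / ℓ := by rw [le_div_iff₀ hℓ0]; linarith
  have hX2 : 0 ≤ (L / ℓ) ^ 2 := sq_nonneg _
  -- the skeleton with the profile T(b) = L/(log b + λ) and the sharp Green bound
  have h4a : 0 ≤ 4 / a := by positivity
  have h4a' : 4 / a ≤ 4 / 5 := div_le_div_of_nonneg_left (by norm_num) (by norm_num) ha5
  have hsk := window_functional_sq_le_atom_tilt_exp_five p (show 2 ≤ Q by omega) (Nat.div_le_self R p)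
    (exitGamma_le_four (R := R) (show 148 ≤ Q by omega)) g (fun b : ℕ => L / (Real.log (b : ℝ) + lam))
  rw [← hDA] at hsk
  have hBf : (Icc 1 Q).filter (· ∈ Nat.smoothNumbers p) = Icc 1 Q := bottom_filter_eq (by omega) hR
  rw [hBf] at hsk ⊢
  -- the three terms
  -- (1) flow
  have hflow : (1 + 4 / a) ^ 2 * L ^ 2 * (1 / (2 * ℓ ^ 2) - 1 / (2 * L ^ 2)) ≤ 81 / 50 * (L / ℓ) ^ 2 := by
    have h1 : (1 + 4 / a) ^ 2 ≤ (9 / 5) ^ 2 := pow_le_pow_left₀ (by linarith) (by linarith) 2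
    have h2 : 1 / (2 * ℓ ^ 2) - 1 / (2 * L ^ 2) ≤ 1 / (2 * ℓ ^ 2) := by
      have : 0 ≤ 1 / (2 * L ^ 2) := by positivity
      linarith
    have h2' : 0 ≤ 1 / (2 * ℓ ^ 2) - 1 / (2 * L ^ 2) := by
      have : 1 / (2 * L ^ 2) ≤ 1 / (2 * ℓ ^ 2) :=
        one_div_le_one_div_of_le (by positivity) (by linarith [pow_le_pow_left₀ hℓ0.le hℓL 2])
      linarith
    have h3 : (9 / 5 : ℝ) ^ 2 * L ^ 2 * (1 / (2 * ℓ ^ 2)) = 81 / 50 * (L / ℓ) ^ 2 := by ring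
    calc (1 + 4 / a) ^ 2 * L ^ 2 * (1 / (2 * ℓ ^ 2) - 1 / (2 * L ^ 2))
        ≤ (9 / 5) ^ 2 * L ^ 2 * (1 / (2 * ℓ ^ 2) - 1 / (2 * L ^ 2)) :=
          mul_le_mul_of_nonneg_right (mul_le_mul_of_nonneg_right h1 (sq_nonneg _)) h2'
      _ ≤ (9 / 5) ^ 2 * L ^ 2 * (1 / (2 * ℓ ^ 2)) := mul_le_mul_of_nonneg_left h2 (by positivity)
      _ = 81 / 50 * (L / ℓ) ^ 2 := h3
  -- (2) flattened χ² · ⌊log₂Q⌋ · e⁵ ≤ 2082000·X²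
  have hchi := flat_chiSq_le_sharp hp hpR hR
  have hres : (∑ b ∈ Icc 1 Q, (b : ℝ) * (exitInflowAtom R Q p b + L / (Real.log (b : ℝ) + lam) / b -
        (∑ a' ∈ Icc 1 Q, (exitInflowAtom R Q p a' + L / (Real.log (a' : ℝ) + lam) / a')) /
          (∑ a' ∈ Icc 1 Q, (1 : ℝ) / a') / b) ^ 2) * ((Nat.log 2 Q : ℝ) * Real.exp 5) ≤
      2082000 * (L / ℓ) ^ 2 := by
    have he := exp_five_lt
    have he0 : 0 < Real.exp 5 := Real.exp_pos 5
    have hχ0 : 0 ≤ ∑ b ∈ Icc 1 Q, (b : ℝ) * (exitInflowAtom R Q p b + L / (Real.log (b : ℝ) + lam) / b -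
        (∑ a' ∈ Icc 1 Q, (exitInflowAtom R Q p a' + L / (Real.log (a' : ℝ) + lam) / a')) /
          (∑ a' ∈ Icc 1 Q, (1 : ℝ) / a') / b) ^ 2 :=
      Finset.sum_nonneg fun b hb => by have := (Finset.mem_Icc.1 hb).1; positivity
    -- χ² ≤ (1+ℓ)·8100·L²/a⁴ ≤ (6/5)a·8100L²/a⁴ = 9720 L²/a³ ≤ 9720 L²/ℓ³
    have hχ2 : ∑ b ∈ Icc 1 Q, (b : ℝ) * (exitInflowAtom R Q p b + L / (Real.log (b : ℝ) + lam) / b -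
        (∑ a' ∈ Icc 1 Q, (exitInflowAtom R Q p a' + L / (Real.log (a' : ℝ) + lam) / a')) /
          (∑ a' ∈ Icc 1 Q, (1 : ℝ) / a') / b) ^ 2 ≤ 9720 * L ^ 2 / ℓ ^ 3 := by
      have h1 : (1 + ℓ) * (90 * L / a ^ 2) ^ 2 = (1 + ℓ) * (8100 * L ^ 2 / a ^ 4) := by ring
      have h2 : (1 + ℓ) ≤ 6 / 5 * a := by linarith
      have h3 : (1 + ℓ) * (8100 * L ^ 2 / a ^ 4) ≤ 6 / 5 * a * (8100 * L ^ 2 / a ^ 4) :=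
        mul_le_mul_of_nonneg_right h2 (by positivity)
      have ha0 : 0 < a := by linarith
      have h4 : 6 / 5 * a * (8100 * L ^ 2 / a ^ 4) = 9720 * L ^ 2 / a ^ 3 := by
        field_simp
        ring
      have h5 : 9720 * L ^ 2 / a ^ 3 ≤ 9720 * L ^ 2 / ℓ ^ 3 :=
        div_le_div_of_nonneg_left (by positivity) (by positivity) (pow_le_pow_left₀ hℓ0.le hℓa 3)
      calc _ ≤ (1 + ℓ) * (90 * L / a ^ 2) ^ 2 := hchi
        _ = (1 + ℓ) * (8100 * L ^ 2 / a ^ 4) := h1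
        _ ≤ 6 / 5 * a * (8100 * L ^ 2 / a ^ 4) := h3
        _ = 9720 * L ^ 2 / a ^ 3 := h4
        _ ≤ 9720 * L ^ 2 / ℓ ^ 3 := h5
    have hN : (Nat.log 2 Q : ℝ) ≤ 1.443 * ℓ := by
      have h1 := natLog_two_le_log_div (show 1 ≤ Q by omega)
      have h2 : ℓ / Real.log 2 ≤ 1.443 * ℓ := by
        rw [div_le_iff₀ (by linarith)]
        have : 0 ≤ ℓ * (1.443 * Real.log 2 - 1) := mul_nonneg hℓ0.le (by linarith)
        linarith
      exact h1.trans h2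
    have hNE : (Nat.log 2 Q : ℝ) * Real.exp 5 ≤ 1.443 * ℓ * 148.42 :=
      mul_le_mul hN he.le he0.le (by positivity)
    have hprod := mul_le_mul hχ2 hNE (by positivity) (by positivity)
    have hid : (9720 * L ^ 2 / ℓ ^ 3) * (1.443 * ℓ * 148.42) = 9720 * 1.443 * 148.42 * (L / ℓ) ^ 2 := by
      field_simp
    rw [hid] at hprod
    have : 9720 * 1.443 * 148.42 * (L / ℓ) ^ 2 ≤ 2082000 * (L / ℓ) ^ 2 :=
      mul_le_mul_of_nonneg_right (by norm_num) hX2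
    exact hprod.trans this
  -- (3) tilt pricing ≤ 2700²·D_Q ≤ 2700²·D_𝒜
  have hθf : ∀ θ ∈ Ico 1 Q, (Icc 1 θ).filter (· ∈ Nat.smoothNumbers p) = Icc 1 θ := fun θ hθ =>
    bottom_filter_eq_of_le (by omega) hR (Finset.mem_Ico.1 hθ).2.le
  have h3eq : ∑ θ ∈ Ico 1 Q, |L / (Real.log ((θ + 1 : ℕ) : ℝ) + lam) - L / (Real.log (θ : ℝ) + lam)| *
        |(∑ b ∈ (Icc 1 θ).filter (· ∈ Nat.smoothNumbers p), (1 : ℝ) / b) * (∑ b ∈ Icc 1 Q, g b / b) /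
            (∑ b ∈ Icc 1 Q, (1 : ℝ) / b) - ∑ b ∈ (Icc 1 θ).filter (· ∈ Nat.smoothNumbers p), g b / b| =
      ∑ θ ∈ Ico 1 Q, |L / (Real.log ((θ + 1 : ℕ) : ℝ) + lam) - L / (Real.log (θ : ℝ) + lam)| *
        |(∑ b ∈ Icc 1 θ, (1 : ℝ) / b) * (∑ b ∈ Icc 1 Q, g b / b) / (∑ b ∈ Icc 1 Q, (1 : ℝ) / b) -
          ∑ b ∈ Icc 1 θ, g b / b| :=
    Finset.sum_congr rfl fun θ hθ => by rw [hθf θ hθ]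
  rw [h3eq] at hsk
  have hprice := tilt_pricing hQ hlam0 hL0.le hL2.le hℓlam g
  rw [← hDQ] at hprice
  have htilt : (∑ θ ∈ Ico 1 Q, |L / (Real.log ((θ + 1 : ℕ) : ℝ) + lam) - L / (Real.log (θ : ℝ) + lam)| *
        |(∑ b ∈ Icc 1 θ, (1 : ℝ) / b) * (∑ b ∈ Icc 1 Q, g b / b) / (∑ b ∈ Icc 1 Q, (1 : ℝ) / b) -
          ∑ b ∈ Icc 1 θ, g b / b|) ^ 2 ≤ 2700 ^ 2 * (L / ℓ) ^ 2 * DA := by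
    calc _ ≤ 2700 ^ 2 * DQ := hprice
      _ ≤ 2700 ^ 2 * DA := mul_le_mul_of_nonneg_left hDQA (by norm_num)
      _ = 2700 ^ 2 * 1 * DA := by ring
      _ ≤ 2700 ^ 2 * (L / ℓ) ^ 2 * DA :=
          mul_le_mul_of_nonneg_right (mul_le_mul_of_nonneg_left (one_le_pow₀ hX1) (by norm_num)) hDAnn
  -- assemble
  calc _ ≤ 3 * ((1 + 4 / a) ^ 2 * L ^ 2 * (1 / (2 * ℓ ^ 2) - 1 / (2 * L ^ 2))) * DA +
        3 * ((∑ b ∈ Icc 1 Q, (b : ℝ) * (exitInflowAtom R Q p b + L / (Real.log (b : ℝ) + lam) / b -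
          (∑ a' ∈ Icc 1 Q, (exitInflowAtom R Q p a' + L / (Real.log (a' : ℝ) + lam) / a')) /
            (∑ a' ∈ Icc 1 Q, (1 : ℝ) / a') / b) ^ 2) * ((Nat.log 2 Q : ℝ) * Real.exp 5)) * DA +
        3 * (∑ θ ∈ Ico 1 Q, |L / (Real.log ((θ + 1 : ℕ) : ℝ) + lam) - L / (Real.log (θ : ℝ) + lam)| *
          |(∑ b ∈ Icc 1 θ, (1 : ℝ) / b) * (∑ b ∈ Icc 1 Q, g b / b) / (∑ b ∈ Icc 1 Q, (1 : ℝ) / b) -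
            ∑ b ∈ Icc 1 θ, g b / b|) ^ 2 := hsk
    _ ≤ 3 * (81 / 50 * (L / ℓ) ^ 2) * DA + 3 * (2082000 * (L / ℓ) ^ 2) * DA +
        3 * (2700 ^ 2 * (L / ℓ) ^ 2 * DA) := by
        have e1 := mul_le_mul_of_nonneg_right (mul_le_mul_of_nonneg_left hflow (by norm_num : (0:ℝ) ≤ 3)) hDAnn
        have e2 := mul_le_mul_of_nonneg_right (mul_le_mul_of_nonneg_left hres (by norm_num : (0:ℝ) ≤ 3)) hDAnn
        have e3 := mul_le_mul_of_nonneg_left htilt (by norm_num : (0:ℝ) ≤ 3)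
        linarith
    _ = (3 * (81 / 50) + 3 * 2082000 + 3 * 2700 ^ 2) * ((L / ℓ) ^ 2 * DA) := by ring
    _ ≤ 30000000 * ((L / ℓ) ^ 2 * DA) :=
        mul_le_mul_of_nonneg_right (by norm_num) (mul_nonneg hX2 hDAnn)
    _ = 30000000 * (L / ℓ) ^ 2 * DA := by ring

end Summit.RiemannHypothesis.RiemannHypothesis.Theorems.IntegerScrew

end
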